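import Summits.PneNP.PneNP.Theses.RootDecompEfProver

/-!
# `RootDecompEfProver.NoFPProverEFGlue` (stmt-PneNP-26833) — glue of the provability split of piece A

Node N1 of the decomp-pnenp root-decomposition cell (route `route-PneNP-RootDecompEfProver`) split
its attacked piece `NoFPProverEF` (A, stmt-PneNP-23777: «no Frege rule list admits a polynomial-time
EF-prover») along the provability rung `U = NoS12ProofOfNPeqCoNP` (stmt-PneNP-26831) into `U` and the
declared residual `ProverIsProvable := U → A` (stmt-PneNP-26832).  This file lands the glue item of
the split: the two children imply the parent, by modus ponens (lens-5 g3 kernel `closes3`, writer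
certificate `bc/N1v3_items.lean::noFPProverEF_of_children`; census tribunal batch 1,
TRIB-PNENP-ROOTDECOMP-1 «glue 26833 provable-now»).  0 sorry; no axioms beyond the route file's.
-/

namespace Summit.PneNP.PneNP.Theorems

/-- Glue of the N1 piece-A split (stmt-PneNP-26833):
`NoS12ProofOfNPeqCoNP → ProverIsProvable → NoFPProverEF`.  Since `ProverIsProvable` is by definition
the implication `NoS12ProofOfNPeqCoNP → NoFPProverEF`, the glue is modus ponens over the route
declarations (decomp-pnenp cell, 2026-08-30). -/
theorem noFPProverEFGlue_proof :
    Summit.PneNP.PneNP.Theses.RootDecompEfProver.NoFPProverEFGlue := by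
  unfold Summit.PneNP.PneNP.Theses.RootDecompEfProver.NoFPProverEFGlue
    Summit.PneNP.PneNP.Theses.RootDecompEfProver.ProverIsProvable
  intro hU hP
  exact hP hU

end Summit.PneNP.PneNP.Theorems
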